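import Literature.Geometry.Lorentzian.SpacetimeMetricInCoordsCalculus
import HarnessLib

/-!
# Pulled-back metric components under an affine reparametrisation of the chart
(crux `GapExhaustion`, stmt-FinalStateConjecture-10808, line photon-shell-pseudoconvexity;
stub (W4-A) `stub_metricInCoords_comp_affine`, the `F1′` glue for the chart form of the
Ionescu–Klainerman local Killing-extension theorem: the near-Kerr chart `Φ : E4 → 𝓢` is
re-parametrised at each point by an affine map `τ(y) = c + L y`, `L` the inverse Kerr–Schild
frame, `c` chosen so that `τ 0` is the centre)

For a spacetime `𝓢`, a map `Φ : E4 → 𝓢` which is `C^∞` (into the manifold) on an open set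
`O ⊆ E4`, a continuous linear map `L : E4 →L[ℝ] E4` and `c ∈ E4`, write `τ(y) = c + L y`. Then

1. `Φ ∘ τ` is `C^∞` on `τ⁻¹(O)` (chain rule);
2. for `τ y ∈ O`, `𝓢.metricInCoords (Φ ∘ τ) y = (𝓢.metricInCoords Φ (τ y)).bilinearComp L L`,
   i.e. `g(d(Φ∘τ)_y v, d(Φ∘τ)_y w) = g(dΦ_{τ y}(L v), dΦ_{τ y}(L w))` — the transformation law of
   a covariant `2`-tensor (O'Neill 1983, Ch. 3, p. 58; tree `Spacetime.metricInCoords_comp`) for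
   the affine `τ`, whose Jacobian is the constant `L`;
3. for `τ y ∈ O` and every `j : ℕ`,
   `‖Dʲ(𝓢.metricInCoords (Φ ∘ τ))(y)‖ ≤ ‖L‖^(j+2) · ‖Dʲ(𝓢.metricInCoords Φ)(τ y)‖`: near `y` the
   new components are `B ∘ (𝓢.metricInCoords Φ) ∘ τ` with `B : G ↦ G(L ·, L ·)` continuous
   LINEAR of operator norm `≤ ‖L‖²` (`compAffine_exists_bilinearCompCLM`), and
   `Dʲ(G ∘ τ)(y) = DʲG(τ y) ∘ (L,…,L)` for the affine `τ` (Mathlib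
   `ContinuousLinearMap.iteratedFDerivWithin_comp_left`,
   `ContinuousLinearMap.iteratedFDerivWithin_comp_right`, `iteratedFDeriv_comp_add_left`), whose
   norm is `≤ ‖DʲG(τ y)‖ · ‖L‖ʲ`.

## References
* [ONeill1983] B. O'Neill, *Semi-Riemannian Geometry*, Academic Press 1983, Ch. 3, p. 58.
-/

noncomputable section

-- instance search through the nested operator types `E4 →L[ℝ] E4 →L[ℝ] ℝ`
set_option maxSynthPendingDepth 3

-- D-0017: single-problem summit, `Summit.<S>.<S>.…` by design (cf. lakefile `weak.linter.dupNamespace`).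
set_option linter.dupNamespace false

namespace Summit.FinalStateConjecture.FinalStateConjecture.Theorems

open Set Function
open Literature.Geometry.Lorentzian
open scoped Manifold ContDiff Topology

/-! ### The linear operation `G ↦ G(L ·, L ·)` on bilinear forms -/

/-- The operation `G ↦ G.bilinearComp L L = G(L ·, L ·)` on the continuous bilinear forms of `E4`
(composition with `L` in both slots) is a continuous LINEAR map of operator norm `≤ ‖L‖²`
(assembled from Mathlib's `ContinuousLinearMap.precomp` / `ContinuousLinearMap.postcomp`; the
bound is `‖G (L v) (L w)‖ ≤ ‖G‖ ‖L‖² ‖v‖ ‖w‖`). [folklore] -/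
theorem compAffine_exists_bilinearCompCLM (L : E4 →L[ℝ] E4) :
    ∃ B : (E4 →L[ℝ] E4 →L[ℝ] ℝ) →L[ℝ] (E4 →L[ℝ] E4 →L[ℝ] ℝ),
      ‖B‖ ≤ ‖L‖ * ‖L‖ ∧ ∀ G : E4 →L[ℝ] E4 →L[ℝ] ℝ, B G = G.bilinearComp L L := by
  set B : (E4 →L[ℝ] E4 →L[ℝ] ℝ) →L[ℝ] (E4 →L[ℝ] E4 →L[ℝ] ℝ) :=
    (ContinuousLinearMap.postcomp E4 (ContinuousLinearMap.precomp ℝ L)).comp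
      (ContinuousLinearMap.precomp (E4 →L[ℝ] ℝ) L)
  have hBapply : ∀ G : E4 →L[ℝ] E4 →L[ℝ] ℝ, B G = G.bilinearComp L L := fun G ↦ by
    ext v w
    rfl
  refine ⟨B, ?_, hBapply⟩
  refine ContinuousLinearMap.opNorm_le_bound _ (by positivity) fun G ↦ ?_
  refine ContinuousLinearMap.opNorm_le_bound₂ _ (by positivity) fun v w ↦ ?_
  rw [hBapply, ContinuousLinearMap.bilinearComp_apply]
  calc ‖G (L v) (L w)‖ ≤ ‖G‖ * ‖L v‖ * ‖L w‖ := G.le_opNorm₂ _ _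
    _ ≤ ‖G‖ * (‖L‖ * ‖v‖) * (‖L‖ * ‖w‖) := by
        gcongr
        · exact L.le_opNorm v
        · exact L.le_opNorm w
    _ = ‖L‖ * ‖L‖ * ‖G‖ * ‖v‖ * ‖w‖ := by ring

/-! ### The affine reparametrisation `τ(y) = c + L y` -/

/-- The affine map `τ(y) = c + L y` is `C^∞`. [folklore] -/
theorem compAffine_contDiff (L : E4 →L[ℝ] E4) (c : E4) :
    ContDiff ℝ ∞ (fun y : E4 => c + L y) :=
  contDiff_const.add L.contDiff

/-- The Jacobian of `τ(y) = c + L y` is the constant `L`. [folklore] -/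
theorem compAffine_fderiv (L : E4 →L[ℝ] E4) (c y : E4) :
    fderiv ℝ (fun y : E4 => c + L y) y = L := by
  rw [fderiv_const_add]
  exact L.fderiv

/-- **Transformation law for an affine reparametrisation.** If `Φ` is differentiable (into the
manifold) at `c + L y`, then
`𝓢.metricInCoords (Φ ∘ τ) y = (𝓢.metricInCoords Φ (c + L y)).bilinearComp L L` for
`τ(y) = c + L y`: `g(d(Φ∘τ)_y v, d(Φ∘τ)_y w) = g(dΦ_{τ y}(L v), dΦ_{τ y}(L w))` (O'Neill 1983,
Ch. 3, p. 58, via the tree chain rule `Spacetime.metricInCoords_comp` and `Dτ = L`).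
[cite: ONeill1983, Ch. 3, p. 58] -/
theorem compAffine_metricInCoords_eq (𝓢 : Spacetime.{0} 4) {Φ : E4 → 𝓢.carrier}
    (L : E4 →L[ℝ] E4) (c : E4) {y : E4}
    (hΦ : MDifferentiableAt 𝓘(ℝ, E4) (𝓡 4) Φ (c + L y)) :
    𝓢.metricInCoords (Φ ∘ fun y : E4 => c + L y) y =
      (𝓢.metricInCoords Φ (c + L y)).bilinearComp L L := by
  rw [𝓢.metricInCoords_comp (θ := fun y : E4 => c + L y) hΦ (L.differentiableAt.const_add c)]
  ext v w
  simp only [bilinPullback_apply, compAffine_fderiv, ContinuousLinearMap.bilinearComp_apply]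

/-- **`Cʲ` size of the components after an affine reparametrisation.** If `Φ` is `C^∞` on the
open set `O` and `c + L y ∈ O`, then for every `j`,
`‖Dʲ(𝓢.metricInCoords (Φ ∘ τ))(y)‖ ≤ ‖L‖^(j+2) · ‖Dʲ(𝓢.metricInCoords Φ)(c + L y)‖`,
`τ(y) = c + L y`: near `y` the new components are `B ∘ (z ↦ 𝓢.metricInCoords Φ (c + z)) ∘ L`
with `B : G ↦ G(L ·, L ·)` linear of norm `≤ ‖L‖²` (`compAffine_exists_bilinearCompCLM`), so
the `j`-th derivative is
`B ∘ Dʲ(𝓢.metricInCoords Φ)(c + L y) ∘ (L, …, L)`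
(Mathlib `ContinuousLinearMap.iteratedFDerivWithin_comp_left/right`,
`iteratedFDeriv_comp_add_left`), of norm at most `‖L‖² · ‖Dʲ(𝓢.metricInCoords Φ)(c + L y)‖ · ‖L‖ʲ`.
[folklore] -/
theorem compAffine_norm_iteratedFDeriv_metricInCoords_le (𝓢 : Spacetime.{0} 4)
    {Φ : E4 → 𝓢.carrier} (L : E4 →L[ℝ] E4) (c : E4) {O : Set E4} (hO : IsOpen O)
    (hΦ : ContMDiffOn 𝓘(ℝ, E4) (𝓡 4) ∞ Φ O) (j : ℕ) {y : E4} (hy : c + L y ∈ O) :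
    ‖iteratedFDeriv ℝ j (𝓢.metricInCoords (Φ ∘ fun y : E4 => c + L y)) y‖ ≤
      ‖L‖ ^ (j + 2) * ‖iteratedFDeriv ℝ j (𝓢.metricInCoords Φ) (c + L y)‖ := by
  obtain ⟨B, hBnorm, hBapply⟩ := compAffine_exists_bilinearCompCLM L
  -- the old components, `C^∞` on `O`, and their translate, `C^∞` on `O' = (c + ·)⁻¹ O`
  have hG : ContDiffOn ℝ ∞ (𝓢.metricInCoords Φ) O := 𝓢.contDiffOn_metricInCoords hO hΦ
  have hO' : IsOpen ((fun z : E4 => c + z) ⁻¹' O) :=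
    hO.preimage (continuous_const.add continuous_id)
  have hG' : ContDiffOn ℝ ∞ (fun z : E4 => 𝓢.metricInCoords Φ (c + z))
      ((fun z : E4 => c + z) ⁻¹' O) :=
    hG.comp (contDiff_const.add contDiff_id).contDiffOn (mapsTo_preimage _ _)
  -- the open neighbourhood `S = L⁻¹ O' = τ⁻¹ O` of `y`
  have hS : IsOpen (L ⁻¹' ((fun z : E4 => c + z) ⁻¹' O)) := hO'.preimage L.continuous
  have hyO' : L y ∈ (fun z : E4 => c + z) ⁻¹' O := hy
  have hyS : y ∈ L ⁻¹' ((fun z : E4 => c + z) ⁻¹' O) := hy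
  have hGL : ContDiffOn ℝ ∞ ((fun z : E4 => 𝓢.metricInCoords Φ (c + z)) ∘ L)
      (L ⁻¹' ((fun z : E4 => c + z) ⁻¹' O)) :=
    hG'.comp_continuousLinearMap L
  -- near `y` the new components are `B ∘ G' ∘ L`
  have hev : 𝓢.metricInCoords (Φ ∘ fun y : E4 => c + L y) =ᶠ[𝓝 y]
      B ∘ ((fun z : E4 => 𝓢.metricInCoords Φ (c + z)) ∘ L) := by
    filter_upwards [hS.mem_nhds hyS] with y' hy'
    have hy'O : c + L y' ∈ O := hy'
    have hΦy' : MDifferentiableAt 𝓘(ℝ, E4) (𝓡 4) Φ (c + L y') :=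
      ((hΦ _ hy'O).contMDiffAt (hO.mem_nhds hy'O)).mdifferentiableAt (by simp)
    rw [compAffine_metricInCoords_eq 𝓢 L c hΦy', comp_apply, comp_apply, hBapply]
  rw [(hev.iteratedFDeriv ℝ j).eq_of_nhds, ← iteratedFDerivWithin_of_isOpen j hS hyS,
    B.iteratedFDerivWithin_comp_left (hGL y hyS) hS.uniqueDiffOn hyS (by exact_mod_cast le_top),
    L.iteratedFDerivWithin_comp_right hG' hO'.uniqueDiffOn hS.uniqueDiffOn hyO'
      (by exact_mod_cast le_top),
    iteratedFDerivWithin_of_isOpen j hO' hyO', iteratedFDeriv_comp_add_left]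
  calc ‖B.compContinuousMultilinearMap
          ((iteratedFDeriv ℝ j (𝓢.metricInCoords Φ) (c + L y)).compContinuousLinearMap
            fun _ => L)‖
      ≤ ‖B‖ *
          ‖(iteratedFDeriv ℝ j (𝓢.metricInCoords Φ) (c + L y)).compContinuousLinearMap
            fun _ => L‖ :=
        ContinuousLinearMap.norm_compContinuousMultilinearMap_le _ _
    _ ≤ (‖L‖ * ‖L‖) *
          (‖iteratedFDeriv ℝ j (𝓢.metricInCoords Φ) (c + L y)‖ * ∏ _i : Fin j, ‖L‖) :=
        mul_le_mul hBnorm (ContinuousMultilinearMap.norm_compContinuousLinearMap_le _ _)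
          (norm_nonneg _) (by positivity)
    _ = ‖L‖ ^ (j + 2) * ‖iteratedFDeriv ℝ j (𝓢.metricInCoords Φ) (c + L y)‖ := by
        rw [Finset.prod_const, Finset.card_univ, Fintype.card_fin]
        ring

/-- (W4-A) pulled-back components under an AFFINE reparametrisation of the chart: the new
components are the old ones at the image point composed with the linear part on both slots,
the new chart is smooth where the old one is, and the `Cʲ` sizes scale by at most `‖L‖^(j+2)`
(O'Neill 1983, Ch. 3, p. 58 for the transformation law; Mathlib's calculus of iterated
derivatives under linear/affine changes of variables for the size bound).
[cite: ONeill1983, Ch. 3, p. 58] -/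
theorem stub_metricInCoords_comp_affine :
    ∀ (𝓢 : Spacetime.{0} 4) (Φ : E4 → 𝓢.carrier) (L : E4 →L[ℝ] E4) (c : E4) (O : Set E4),
      IsOpen O → ContMDiffOn 𝓘(ℝ, E4) (𝓡 4) ∞ Φ O →
      ContMDiffOn 𝓘(ℝ, E4) (𝓡 4) ∞ (Φ ∘ fun y : E4 => c + L y) ((fun y : E4 => c + L y) ⁻¹' O) ∧
      (∀ y : E4, c + L y ∈ O →
        𝓢.metricInCoords (Φ ∘ fun y : E4 => c + L y) y =
          (𝓢.metricInCoords Φ (c + L y)).bilinearComp L L) ∧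
      (∀ (j : ℕ) (y : E4), c + L y ∈ O →
        ‖iteratedFDeriv ℝ j (𝓢.metricInCoords (Φ ∘ fun y : E4 => c + L y)) y‖ ≤
          ‖L‖ ^ (j + 2) * ‖iteratedFDeriv ℝ j (𝓢.metricInCoords Φ) (c + L y)‖) := by
  intro 𝓢 Φ L c O hO hΦ
  refine ⟨hΦ.comp (compAffine_contDiff L c).contMDiff.contMDiffOn fun _ hy ↦ hy,
    fun y hy ↦ ?_, fun j y hy ↦ compAffine_norm_iteratedFDeriv_metricInCoords_le 𝓢 L c hO hΦ j hy⟩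
  exact compAffine_metricInCoords_eq 𝓢 L c
    (((hΦ _ hy).contMDiffAt (hO.mem_nhds hy)).mdifferentiableAt (by simp))

end Summit.FinalStateConjecture.FinalStateConjecture.Theorems

end
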